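import Summits.ValiantsHypothesis.ValiantsHypothesis.Theorems.FeketeSOSFeketeSOSHardPaleyRIPTradeoff

/-!
# Route FeketeSOS — crux `FeketeSOSHard` (stmt-ValiantsHypothesis-3996), line `paley-rip` (skeleton v3):
# the trade-off composition WITH SUPPORT INFLATION — `B_κ ∧ T̃_γ ⇒ X` for `κ > (γ − 1)/2`

`…PaleyRIPTradeoff.lean` (p582034) proves `B_κ ∧ T_γ ⇒ FeketeSOSHard` for `κ > (γ−1)/2`, where `T_γ` replaces weighted
squares supported in `S` by squares supported in THE SAME `S`.  The repair census (`Lines/paley-rip-stub3-census.md` §9)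
proves operator tameness (math) on every support CONTAINED in an iterated direct sumset `D₁ + ⋯ + D_J + [0,k)`, with the new
squares living on the ambient structured support; and the flat-RIP engine only ever sees the SIZE of the supports and the
mass.  So the natural — weaker, and by §9 plausibly provable — operator stub allows SUPPORT INFLATION:

  `T̃_γ`: for every `ι > 0` there is `K` such that every family of `r` weighted squares supported in `S ⊆ [0,p)` with cyclic
  pattern of modulus `≤ M` is carried by squares supported in SOME `S' ⊆ [0,p)` with `#S' ≤ K·r^K·#S^{1+ι}` and of total
  mass `≤ K·r^K·#S^γ·M`.

This file proves `B_κ ∧ T̃_γ ⇒ FeketeSOSHard` whenever `κ > (γ − 1)/2` (`feketeSOSHard_of_flatRIP_of_tameOperatorInfl`), sorry-free,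
hypotheses inline: the kernel-checked composition for a v4 skeleton whose operator stub is `T̃_{1+ε}` (or `T̃_γ` paired with an
explicit `κ`).  Parameters: `g = κ − (γ−1)/2`, `ι = δ₁`, `δ = min(g/(2(K+γ+1)), (2δ₁/3)/(2(K+2+δ₁)))`, `η = κ − g/4`,
`p ≥ max(p₁, ⌈K^{4/g}⌉, ⌈K^{6/δ₁}⌉, ⌈2^{4/g}⌉, 3)`.

Honest framing: neither B nor any `T̃_γ` with `γ < 3/2` is proved here; the crux stays OPEN; `VP ≠ VNP` untouched.
-/

set_option linter.dupNamespace false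

namespace Summit.ValiantsHypothesis.ValiantsHypothesis.Theorems.FeketeSOSHardPaleyRIP

open Polynomial Finset
open scoped BigOperators
open Summit.ValiantsHypothesis.ValiantsHypothesis.Theses

noncomputable section

/-- **`B_κ ∧ T̃_γ ⇒ X` whenever `κ > (γ−1)/2` (operator tameness WITH support inflation).** [folklore] -/
theorem feketeSOSHard_of_flatRIP_of_tameOperatorInfl (κ δ₁ γ : ℝ) (hδ₁ : 0 < δ₁)
    (hγ : 0 ≤ γ) (hgap : (γ - 1) / 2 < κ)
    (hB : ∃ p₁ : ℕ, ∀ (p : ℕ) [Fact p.Prime], p₁ ≤ p →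
      ∀ (S : Finset ℕ), (∀ a ∈ S, a < p) → (S.card : ℝ) ≤ (p : ℝ) ^ (1 / 2 + δ₁) →
      ∀ (w : ℕ → ℂ), ‖paleyForm p S w‖ ≤ (p : ℝ) ^ (1 / 2 - κ) * ∑ a ∈ S, ‖w a‖ ^ 2)
    (hT : ∀ ι : ℝ, 0 < ι → ∃ K : ℝ, 0 < K ∧ ∀ (p : ℕ) [Fact p.Prime] (r : ℕ) (S : Finset ℕ), (∀ a ∈ S, a < p) →
      ∀ (c : Fin r → ℂ) (w : Fin r → ℂ[X]), (∀ i, (w i).support ⊆ S) →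
      ∀ (F : ℂ[X]) (M : ℝ), F.natDegree < p → ((X : ℂ[X]) ^ p - 1 ∣ (∑ i, C (c i) * w i ^ 2) - F) →
        (∀ n, ‖F.coeff n‖ ≤ M) →
        ∃ (S' : Finset ℕ) (s' : ℕ) (c' : Fin s' → ℂ) (w' : Fin s' → ℂ[X]), (∀ a ∈ S', a < p) ∧
          ((S'.card : ℝ) ≤ K * (r : ℝ) ^ K * (S.card : ℝ) ^ (1 + ι)) ∧ (∀ j, (w' j).support ⊆ S') ∧
          ((X : ℂ[X]) ^ p - 1 ∣ (∑ j, C (c' j) * w' j ^ 2) - F) ∧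
          (∑ j, sqMass (c' j) (w' j)) ≤ K * (r : ℝ) ^ K * (S.card : ℝ) ^ γ * M) :
    FeketeSOS.FeketeSOSHard := by
  classical
  obtain ⟨p₁, hB⟩ := hB
  -- inflation exponent `ι := δ₁`
  obtain ⟨K, hK, hT⟩ := hT δ₁ hδ₁
  -- the gap and the parameters
  set g : ℝ := κ - (γ - 1) / 2 with hgdef
  have hg : 0 < g := by rw [hgdef]; linarith
  set g₂ : ℝ := 2 * δ₁ / 3 with hg₂def
  have hg₂ : 0 < g₂ := by rw [hg₂def]; positivity
  have h2K : (0 : ℝ) < 2 * (K + γ + 1) := by positivity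
  have h2K' : (0 : ℝ) < 2 * (K + (1 + δ₁) + 1) := by positivity
  set δ : ℝ := min (g / (2 * (K + γ + 1))) (g₂ / (2 * (K + (1 + δ₁) + 1))) with hδdef
  have hδ : 0 < δ := lt_min (div_pos hg h2K) (div_pos hg₂ h2K')
  have hδle : δ * (2 * (K + γ + 1)) ≤ g := by
    have h : δ ≤ g / (2 * (K + γ + 1)) := min_le_left _ _
    rwa [le_div_iff₀ h2K] at h
  have hδle' : δ * (2 * (K + (1 + δ₁) + 1)) ≤ g₂ := by
    have h : δ ≤ g₂ / (2 * (K + (1 + δ₁) + 1)) := min_le_right _ _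
    rwa [le_div_iff₀ h2K'] at h
  set η : ℝ := κ - g / 4 with hηdef
  have hηκ : η < κ := by rw [hηdef]; linarith
  obtain ⟨N₁, hN₁⟩ : ∃ N : ℕ, K ^ (1 / (g / 4)) ≤ (N : ℝ) := ⟨_, Nat.le_ceil _⟩
  obtain ⟨N₁', hN₁'⟩ : ∃ N : ℕ, K ^ (1 / (g₂ / 4)) ≤ (N : ℝ) := ⟨_, Nat.le_ceil _⟩
  obtain ⟨N₂, hN₂⟩ : ∃ N : ℕ, (2 : ℝ) ^ (1 / (κ - η)) ≤ (N : ℝ) := ⟨_, Nat.le_ceil _⟩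
  refine ⟨δ, hδ, max p₁ (max N₁ (max N₁' (max N₂ 3))), ?_⟩
  intro p _ hp s c g₀ hs hdeg hrep
  have hprime : p.Prime := Fact.out
  have hp₁ : p₁ ≤ p := le_trans (le_max_left _ _) hp
  have hpN₁ : N₁ ≤ p := le_trans (le_trans (le_max_left _ _) (le_max_right _ _)) hp
  have hpN₁' : N₁' ≤ p :=
    le_trans (le_trans (le_trans (le_max_left _ _) (le_max_right _ _)) (le_max_right _ _)) hp
  have hpN₂ : N₂ ≤ p :=
    le_trans (le_trans (le_trans (le_trans (le_max_left _ _) (le_max_right _ _)) (le_max_right _ _))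
      (le_max_right _ _)) hp
  have hp3 : 3 ≤ p :=
    le_trans (le_trans (le_trans (le_trans (le_max_right _ _) (le_max_right _ _)) (le_max_right _ _))
      (le_max_right _ _)) hp
  have hp1 : (1 : ℝ) < (p : ℝ) := by exact_mod_cast hprime.one_lt
  have hp0 : (0 : ℝ) < (p : ℝ) := by linarith
  by_contra hlt
  have hlt' : (∑ i, ((g₀ i).support.card : ℝ)) < (p : ℝ) ^ (1 / 2 + δ) := not_le.1 hlt
  -- fold to one joint support
  have hdvd : (X : ℂ[X]) ^ p - 1 ∣ (∑ i, C (c i) * g₀ i ^ 2) - fek p := by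
    have hrep' : (∑ i, C (c i) * g₀ i ^ 2) = fek p := by rw [hrep]; rfl
    rw [hrep', sub_self]; exact dvd_zero _
  obtain ⟨S, g', hS, hsuppS, hcardS, hdvd'⟩ := jointSupport_fold p s c g₀ hdvd
  have hcardS' : (S.card : ℝ) ≤ (p : ℝ) ^ (1 / 2 + δ) := (hcardS.trans_lt hlt').le
  -- operator tameness with inflation, F = F_p, M = 1
  obtain ⟨S', s', c', w', hS', hcardS'', hsupp', hdvd'', hmass⟩ :=
    hT p s S hS c g' hsuppS (fek p) 1 (fek_natDegree_lt p) hdvd' (coeff_fek_norm_le_one p)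
  have hKp : K ≤ (p : ℝ) ^ (g / 4) := le_rpow_of_rpow_le_nat p (by positivity) hK N₁ hN₁ hpN₁
  have hKp' : K ≤ (p : ℝ) ^ (g₂ / 4) := le_rpow_of_rpow_le_nat p (by positivity) hK N₁' hN₁' hpN₁'
  have hmass' : (∑ j, sqMass (c' j) (w' j)) ≤ (p : ℝ) ^ (1 / 2 + η) := by
    have h := tradeoff_mass_le (p := p) hp1 hγ hK hδ hδle (Nat.cast_nonneg s) hs
      (Nat.cast_nonneg S.card) hcardS' hKp
    have hexp : γ / 2 + 3 * g / 4 = 1 / 2 + η := by rw [hηdef, hgdef]; ring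
    calc (∑ j, sqMass (c' j) (w' j)) ≤ K * (s : ℝ) ^ K * (S.card : ℝ) ^ γ * 1 := hmass
      _ = K * (s : ℝ) ^ K * (S.card : ℝ) ^ γ := mul_one _
      _ ≤ (p : ℝ) ^ (γ / 2 + 3 * g / 4) := h
      _ = (p : ℝ) ^ (1 / 2 + η) := by rw [hexp]
  -- the inflated support is still `p^{1/2+δ₁}`-sparse
  have hS'card : (S'.card : ℝ) ≤ (p : ℝ) ^ (1 / 2 + δ₁) := by
    have h := tradeoff_mass_le (p := p) (γ := 1 + δ₁) hp1 (by linarith) hK hδ hδle' (Nat.cast_nonneg s) hs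
      (Nat.cast_nonneg S.card) hcardS' hKp'
    have hexp : (1 + δ₁) / 2 + 3 * g₂ / 4 = 1 / 2 + δ₁ := by rw [hg₂def]; ring
    calc (S'.card : ℝ) ≤ K * (s : ℝ) ^ K * (S.card : ℝ) ^ (1 + δ₁) := hcardS''
      _ ≤ (p : ℝ) ^ ((1 + δ₁) / 2 + 3 * g₂ / 4) := h
      _ = (p : ℝ) ^ (1 / 2 + δ₁) := by rw [hexp]
  have hdeg'' : ∀ j, (w' j).natDegree < p := fun j =>
    natDegree_lt_of_subset_range p hprime.pos hS' (hsupp' j)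
  have hsuppcard : ∀ j, ((w' j).support.card : ℝ) ≤ (p : ℝ) ^ (1 / 2 + δ₁) := fun j =>
    le_trans (by exact_mod_cast Finset.card_le_card (hsupp' j)) hS'card
  -- flat-RIP gap and contradiction
  have hgap' := rpow_gap (p := p) hηκ N₂ hN₂ hpN₂ hp3
  have hgt := mass_gt_of_flatRIPAt p κ δ₁ η (hB p hp₁) hgap' s' c' w' hdeg'' hsuppcard hdvd''
  linarith

end

end Summit.ValiantsHypothesis.ValiantsHypothesis.Theorems.FeketeSOSHardPaleyRIP
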